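import Summits.ABC.ABC.Theses.DefiniteXi
import Literature.NumberTheory.EllipticCurves.TakahashiDegreeFormulaCoprimeProofs
import Literature.NumberTheory.EllipticCurves.PastenSpectralDegree
import Literature.NumberTheory.Automorphic.ShimuraCurveRibetTakahashiPairwiseEisensteinProofs
import HarnessLib

/-!
# STUB-IDEAS companion — `stub_takahashi` · ideator k3 · generation 14 (FAMILY 3)

Crux `stmt-ABC-11338` (`DefiniteXi.DefiniteRTControlPrime`), stub
`theorem stub_takahashi : takahashi2001_thm_2_3_of_coprime` (a cite-tagged named fact).

Contents (statements elaborate; the only `sorry` is the mechanical re-glue N2, flagged as ONE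
prover cycle = p838145's proof with its line 304 replaced):
* L0  `#check` of the tree derivation of the stub from the dictionary package `hDict`.
* N1  `TakahashiDegreeLeOfCoprime` — the CONSUMER-MINIMAL form of the leaf for THIS crux
      (both landed closures p97354 / p838145 use the fact only through
      `takahashi2001_thm_2_3_of_coprime.modularDegree_le_brandtXi_mul`), with
      `takahashiDegreeLe_of_fact` (PROVED, one line) and the necessity check `brandtXi_pos_of_degreeLe`
      (PROVED: N1 still forces the honest eigen-line, as k2-g6 showed for the stub).
* N2  `definiteRTControlPrime_of_degreeLe_of_pasten163` — statement only (sorry): the crux from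
      N1 + Pasten's `163·δ` bound.
-/

set_option linter.dupNamespace false

namespace Summit.ABC.ABC.Cruxes.DefiniteRTControlPrime.StubIdeas3G14

open Literature.NumberTheory.EllipticCurves
open Literature.NumberTheory.EllipticCurves.ModularForms
open Literature.NumberTheory.Automorphic

/-! ## L0 — the tree's derivation of the stub from the dictionary package (section hypothesis `hDict`) -/
#check @Literature.NumberTheory.Automorphic.takahashi2001_thm_2_3_of_coprime_of_brandtDictionary

/-! ## N1 — consumer-minimal leaf for the ABC crux -/

/-- **N1.** `δ₁(Mr) ≤ ξ(E; M, r) · ord_r Δ_min(E)` for the optimal curve `E` of conductor `M r`,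
`r ∥ M r` (Takahashi 2001 Thm 2.3 read one-sidedly: `δ i = ξ j`, `i ≥ 1`, `j ≤ i j = c_r`). This is
the ONLY shape in which `DefiniteRTControlPrime`'s closures consume the fact
(`DefiniteXiDefiniteRTControlPrimeTwoFacts.lean` l.304, `DefiniteXiDefiniteRTControlPrime.lean` l.185).
[cite: Takahashi2001, Thm. 2.3 (p. 79)] -/
def TakahashiDegreeLeOfCoprime : Prop :=
  ∀ (W : WeierstrassCurve ℚ) [W.IsElliptic] (M r : ℕ) [NeZero (M * r)],
    r.Prime → M.Coprime r → W.conductorNorm ℤ = M * r →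
    ∀ P : ModularParametrizationData W (M * r),
      (∀ (W' : WeierstrassCurve ℚ) [W'.IsElliptic], W'.conductorNorm ℤ = M * r →
          ∀ P' : ModularParametrizationData W' (M * r),
          P'.f = P.f → P.modularDegree ≤ P'.modularDegree) →
      P.modularDegree ≤
        brandtXi M r (fun n => W.LFunction n) * (W.minimalDiscriminantNorm ℤ).factorization r

/-- The registered stub (full Thm 2.3) gives N1 — verbatim the tree corollary. -/
theorem takahashiDegreeLe_of_fact (h : takahashi2001_thm_2_3_of_coprime) :
    TakahashiDegreeLeOfCoprime :=
  fun W _ M r _ hr hcop hN P hmin =>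
    takahashi2001_thm_2_3_of_coprime.modularDegree_le_brandtXi_mul h W M r hr hcop hN P hmin

/-- Necessity check (FAMILY 3, what a counterexample must look like): N1 still forces `ξ ≥ 1`,
i.e. an honest `a(E)`-eigen-line of the Brandt matrices of type `(M, r)` (junk `brandtXi = 0` off
rank one would contradict `deg ≥ 1`), exactly as the full stub does (k2-g6 `xi_ne_zero_of_stub`). -/
theorem brandtXi_pos_of_degreeLe (h : TakahashiDegreeLeOfCoprime) (W : WeierstrassCurve ℚ)
    [W.IsElliptic] (M r : ℕ) [NeZero (M * r)] (hr : r.Prime) (hcop : M.Coprime r)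
    (hN : W.conductorNorm ℤ = M * r) (P : ModularParametrizationData W (M * r))
    (hmin : ∀ (W' : WeierstrassCurve ℚ) [W'.IsElliptic], W'.conductorNorm ℤ = M * r →
      ∀ P' : ModularParametrizationData W' (M * r),
        P'.f = P.f → P.modularDegree ≤ P'.modularDegree) :
    0 < brandtXi M r (fun n => W.LFunction n) := by
  have hle := h W M r hr hcop hN P hmin
  refine Nat.pos_of_ne_zero fun h0 => ?_
  rw [h0, zero_mul] at hle
  exact absurd hle (not_le.mpr P.deg_pos)

/-! ## N2 — the re-glue through N1 (ONE prover cycle; statement only here) -/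

/-- **N2.** `DefiniteRTControlPrime` from N1 and Pasten's `163 · δ` bound, `C = 4·163³`: the proof is
p838145's `definiteRTControlPrime_of_two_facts` (ll. 269–310) with the single call
`takahashi2001_thm_2_3_of_coprime.modularDegree_le_brandtXi_mul hT Ws M q hq hcop hNs Ps hPsmin`
(l.304) replaced by `h Ws M q hq hcop hNs Ps hPsmin`. Left as `sorry` (stub-ideation does not prove). -/
theorem definiteRTControlPrime_of_degreeLe_of_pasten163 (h : TakahashiDegreeLeOfCoprime)
    (h163 : PastenShimura2024_minimalDegree_le_163_mul) :
    Summit.ABC.ABC.Theses.DefiniteXi.DefiniteRTControlPrime := by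
  sorry

end Summit.ABC.ABC.Cruxes.DefiniteRTControlPrime.StubIdeas3G14
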